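import Mathlib
import Literature.RingTheory.MvPowerSeries.PartialDerivative
import HarnessLib

/-!
# Crux `NarrowRunsDie` (stmt-ResolutionOfSingularities-16882, route `WildCones`), line `derivlift` —
# stub `stub_partialsDivisible`

Registered stub of the line skeleton `Cruxes/NarrowRunsDie/Lines/derivlift.lean` (v3), stated over the
route's inlined `let` calculus VERBATIM. See the skeleton docstring of `Sig.stub_partialsDivisible` for the paper proof.

Proof (derivation lift). With `σ = sub i τ` the substitution `u_i ↦ u_i`, `u_j ↦ u_i (u_j + τ_j)` (an honest
`MvPowerSeries.subst` of a zero-constant family `a`) and `∂_k = Literature.RingTheory.MvPowerSeries.pd k`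
(definitionally the `pd` let), the chain rule `pd_subst` gives, for every coefficient vector `c`, an explicit
`c'` (independent of `F`) with `X_i · σ(Σ_k c_k ∂_k F) = Σ_j c'_j ∂_j (σ F)` (`pdiv_step`, verified pointwise
through `Σ_j c'_j ∂_j (a k) = σ(c_k) X_i`, `pdiv_sum_next_mul_pd`). By induction on `m`,
`π_m Φ_m(∂_l g) = Σ_k c_k ∂_k (Φ_m g)` (`pdiv_lift`); derivations kill `p`-th powers in characteristic `p`
(`pdiv_pd_pow_char`), so `Φ_m g = π_m^p h + b^p` gives `π_m Φ_m(∂_l g) = π_m^p · Σ_k c_k ∂_k h` (`pdiv_main`).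
All helpers are stated over an abstract family `a` / abstract `Phi`, `piE` satisfying the defining equations
of the `let`s, which the stub discharges by `rfl`.
-/

noncomputable section

set_option linter.dupNamespace false

namespace Summit.ResolutionOfSingularities.ResolutionOfSingularities.Theorems.NarrowRunsDie

open MvPowerSeries Literature.RingTheory.MvPowerSeries

section PdivHelpers

variable {n : ℕ} {κ : Type} [Field κ]

/-- A family `a` with `a i = X i`, `a j = X i * (X j + C (τ j))` (`j ≠ i`) has zero constant coefficients. -/
theorem pdiv_constantCoeff {a : Fin n → MvPowerSeries (Fin n) κ} {i : Fin n} {τ : Fin n → κ}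
    (hai : a i = X i) (han : ∀ j, j ≠ i → a j = X i * (X j + C (τ j))) (j : Fin n) :
    constantCoeff (a j) = 0 := by
  by_cases h : j = i
  · rw [h, hai]; simp
  · rw [han j h]; simp

/-- `∂_j (a i) = [i = j]`. -/
theorem pdiv_pd_self {a : Fin n → MvPowerSeries (Fin n) κ} {i : Fin n} (hai : a i = X i) (j : Fin n) :
    pd j (a i) = if i = j then 1 else 0 := by
  rw [hai, pd_X]

/-- `∂_j (a k) = [i = j] (X k + C (τ k)) + X i [k = j]` for `k ≠ i`. -/
theorem pdiv_pd_ne {a : Fin n → MvPowerSeries (Fin n) κ} {i : Fin n} {τ : Fin n → κ}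
    (han : ∀ j, j ≠ i → a j = X i * (X j + C (τ j))) {k : Fin n} (h : k ≠ i) (j : Fin n) :
    pd j (a k) = (if i = j then 1 else 0) * (X k + C (τ k)) + X i * (if k = j then 1 else 0) := by
  rw [han k h, pd_mul, map_add, pd_X, pd_X, pd_C, add_zero]

/-- Pointwise key identity behind the one-step lift: if `c'_i = σ(c_i) X_i` and
`c'_j = σ(c_j) - σ(c_i) (X_j + C τ_j)` (`j ≠ i`), then `Σ_j c'_j · ∂_j (a k) = σ(c_k) · X_i`. -/
theorem pdiv_sum_next_mul_pd {a : Fin n → MvPowerSeries (Fin n) κ} {i : Fin n} {τ : Fin n → κ}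
    (hai : a i = X i) (han : ∀ j, j ≠ i → a j = X i * (X j + C (τ j)))
    {c c' : Fin n → MvPowerSeries (Fin n) κ} (hci : c' i = subst a (c i) * X i)
    (hcj : ∀ j, j ≠ i → c' j = subst a (c j) - subst a (c i) * (X j + C (τ j))) (k : Fin n) :
    ∑ j, c' j * pd j (a k) = subst a (c k) * X i := by
  by_cases hk : k = i
  · rw [hk]
    simp only [pdiv_pd_self hai, mul_ite, mul_one, mul_zero, Finset.sum_ite_eq, Finset.mem_univ,
      if_true, hci]
  · simp only [pdiv_pd_ne han hk, mul_add, Finset.sum_add_distrib, ite_mul, one_mul, zero_mul,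
      mul_ite, mul_one, mul_zero, Finset.sum_ite_eq, Finset.mem_univ, if_true, hci, hcj k hk]
    ring

/-- ONE SUBSTITUTION STEP of the lifted derivation (chain rule `pd_subst`):
`X_i · σ(Σ_k c_k ∂_k F) = Σ_j c'_j ∂_j (σ F)` with `c'` as in `pdiv_sum_next_mul_pd`, independent of `F`. -/
theorem pdiv_step {a : Fin n → MvPowerSeries (Fin n) κ} {i : Fin n} {τ : Fin n → κ}
    (hai : a i = X i) (han : ∀ j, j ≠ i → a j = X i * (X j + C (τ j)))
    {c c' : Fin n → MvPowerSeries (Fin n) κ} (hci : c' i = subst a (c i) * X i)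
    (hcj : ∀ j, j ≠ i → c' j = subst a (c j) - subst a (c i) * (X j + C (τ j)))
    (F : MvPowerSeries (Fin n) κ) :
    X i * subst a (∑ k, c k * pd k F) = ∑ j, c' j * pd j (subst a F) := by
  have ha0 : ∀ j, constantCoeff (a j) = 0 := pdiv_constantCoeff hai han
  have hS : HasSubst a := hasSubst_of_constantCoeff_zero ha0
  have hL : subst a (∑ k, c k * pd k F) = ∑ k, subst a (c k) * subst a (pd k F) := by
    rw [← coe_substAlgHom hS, map_sum]
    exact Finset.sum_congr rfl fun k _ => map_mul _ _ _
  have hR : ∀ j, pd j (subst a F) = ∑ k, subst a (pd k F) * pd j (a k) := pd_subst a ha0 F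
  calc X i * subst a (∑ k, c k * pd k F)
      = ∑ k, X i * (subst a (c k) * subst a (pd k F)) := by rw [hL, Finset.mul_sum]
    _ = ∑ k, subst a (pd k F) * ∑ j, c' j * pd j (a k) := by
        refine Finset.sum_congr rfl fun k _ => ?_
        rw [pdiv_sum_next_mul_pd hai han hci hcj]; ring
    _ = ∑ j, c' j * ∑ k, subst a (pd k F) * pd j (a k) := by
        simp only [Finset.mul_sum]
        rw [Finset.sum_comm]
        exact Finset.sum_congr rfl fun _ _ => Finset.sum_congr rfl fun _ _ => by ring
    _ = ∑ j, c' j * pd j (subst a F) := by simp only [hR]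

/-- DERIVATION LIFT: `π_m · Φ_m(∂_l g) = Σ_k c_k ∂_k (Φ_m g)` for a coefficient vector `c` depending
only on `m` (and the word), not on `g`. Here `a k` is the substitution family of step `k`, and `Phi`, `piE`
are any functions satisfying the recursions of the `let`s. -/
theorem pdiv_lift (i : ℕ → Fin n) (t : ℕ → Fin n → κ) {a : ℕ → Fin n → MvPowerSeries (Fin n) κ}
    (hai : ∀ k, a k (i k) = X (i k)) (han : ∀ k j, j ≠ i k → a k j = X (i k) * (X j + C (t k j)))
    {Phi : ℕ → MvPowerSeries (Fin n) κ → MvPowerSeries (Fin n) κ} {piE : ℕ → MvPowerSeries (Fin n) κ}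
    (hPhi0 : ∀ f, Phi 0 f = f) (hPhiS : ∀ m f, Phi (m + 1) f = subst (a m) (Phi m f))
    (hpiE0 : piE 0 = 1) (hpiES : ∀ m, piE (m + 1) = X (i m) * subst (a m) (piE m))
    (l : Fin n) (m : ℕ) :
    ∃ c : Fin n → MvPowerSeries (Fin n) κ, ∀ g : MvPowerSeries (Fin n) κ,
      piE m * Phi m (pd l g) = ∑ k, c k * pd k (Phi m g) := by
  induction m with
  | zero =>
    refine ⟨Pi.single l 1, fun g => ?_⟩
    rw [hpiE0, hPhi0, hPhi0]
    simp only [Pi.single_apply, ite_mul, one_mul, zero_mul, Finset.sum_ite_eq', Finset.mem_univ,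
      if_true]
  | succ m ih =>
    obtain ⟨c, hc⟩ := ih
    refine ⟨fun j => if j = i m then subst (a m) (c (i m)) * X (i m)
      else subst (a m) (c j) - subst (a m) (c (i m)) * (X j + C (t m j)), fun g => ?_⟩
    have hS : HasSubst (a m) := hasSubst_of_constantCoeff_zero (pdiv_constantCoeff (hai m) (han m))
    rw [hpiES, hPhiS, hPhiS, mul_assoc, ← subst_mul hS, hc g]
    exact pdiv_step (hai m) (han m) (if_pos rfl) (fun j hj => if_neg hj) (Phi m g)

/-- Derivations kill `p`-th powers in characteristic `p`: `∂_k (x ^ p) = 0`. -/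
theorem pdiv_pd_pow_char (p : ℕ) [CharP κ p] (k : Fin n) (x : MvPowerSeries (Fin n) κ) :
    pd k (x ^ p) = 0 := by
  cases p with
  | zero => rw [pow_zero, pd_one]
  | succ q =>
    haveI : CharP (MvPowerSeries (Fin n) κ) (q + 1) :=
      charP_of_injective_ringHom (f := (C : κ →+* MvPowerSeries (Fin n) κ)) C_injective (q + 1)
    rw [pd_pow_succ, CharP.cast_eq_zero, zero_mul, zero_mul]

/-- The stub over abstract `a`, `Phi`, `piE`: `Φ_m g = π_m^p h + b^p ⇒ π_m Φ_m(∂_l g) ∈ (π_m^p)`. -/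
theorem pdiv_main (p : ℕ) [CharP κ p] (i : ℕ → Fin n) (t : ℕ → Fin n → κ)
    {a : ℕ → Fin n → MvPowerSeries (Fin n) κ}
    (hai : ∀ k, a k (i k) = X (i k)) (han : ∀ k j, j ≠ i k → a k j = X (i k) * (X j + C (t k j)))
    {Phi : ℕ → MvPowerSeries (Fin n) κ → MvPowerSeries (Fin n) κ} {piE : ℕ → MvPowerSeries (Fin n) κ}
    (hPhi0 : ∀ f, Phi 0 f = f) (hPhiS : ∀ m f, Phi (m + 1) f = subst (a m) (Phi m f))
    (hpiE0 : piE 0 = 1) (hpiES : ∀ m, piE (m + 1) = X (i m) * subst (a m) (piE m))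
    (m : ℕ) (l : Fin n) (g h b : MvPowerSeries (Fin n) κ) (hΦ : Phi m g = piE m ^ p * h + b ^ p) :
    ∃ h' : MvPowerSeries (Fin n) κ, piE m * Phi m (pd l g) = piE m ^ p * h' := by
  obtain ⟨c, hc⟩ := pdiv_lift i t hai han hPhi0 hPhiS hpiE0 hpiES l m
  refine ⟨∑ k, c k * pd k h, ?_⟩
  rw [hc g, hΦ, Finset.mul_sum]
  refine Finset.sum_congr rfl fun k _ => ?_
  rw [map_add, pd_mul, pdiv_pd_pow_char, pdiv_pd_pow_char, zero_mul, zero_add, add_zero]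
  ring

end PdivHelpers

/-- `stub_partialsDivisible` — DERIVATION LIFT (valid for EVERY word, no freeness, no state): if
`Φ_m(g) = π_m^p h + b^p` then `π_m · Φ_m(∂_l g) ∈ π_m^p · κ[[u]]` for every coordinate `l`. The registered
stub signature of line `derivlift` (crux `WildCones.NarrowRunsDie`), verbatim copy of the skeleton's
`Sig.stub_partialsDivisible` (route `let` calculus inlined); folklore. -/
def Sig.stub_partialsDivisible : Prop :=
  ∀ p : ℕ, p.Prime → ∀ n : ℕ, 0 < n → ∀ (κ : Type) [Field κ] [CharP κ p]
    (i : ℕ → Fin n) (t : ℕ → Fin n → κ),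
    let pd : Fin n → MvPowerSeries (Fin n) κ → MvPowerSeries (Fin n) κ := fun i f => show MvPowerSeries (Fin n) κ from fun A : Fin n →₀ ℕ => ((A i + 1 : ℕ) : κ) * f (A + Finsupp.single i 1);
    let sub : Fin n → (Fin n → κ) → MvPowerSeries (Fin n) κ → MvPowerSeries (Fin n) κ := fun i τ f => MvPowerSeries.subst (fun j : Fin n => @ite (MvPowerSeries (Fin n) κ) (j = i) (Classical.dec _) (MvPowerSeries.X i) (MvPowerSeries.X i * (MvPowerSeries.X j + MvPowerSeries.C (τ j)))) f;
    let Phi : ℕ → MvPowerSeries (Fin n) κ → MvPowerSeries (Fin n) κ := fun m f => @Nat.rec (fun _ => MvPowerSeries (Fin n) κ) f (fun k g => sub (i k) (t k) g) m;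
    let piE : ℕ → MvPowerSeries (Fin n) κ := fun m => @Nat.rec (fun _ => MvPowerSeries (Fin n) κ) 1 (fun k g => MvPowerSeries.X (i k) * sub (i k) (t k) g) m;
    ∀ (m : ℕ) (l : Fin n) (g h b : MvPowerSeries (Fin n) κ),
      Phi m g = piE m ^ p * h + b ^ p →
      ∃ h' : MvPowerSeries (Fin n) κ, piE m * Phi m (pd l g) = piE m ^ p * h'

/-- Stub `stub_partialsDivisible` of line `derivlift` for crux `WildCones.NarrowRunsDie` (registered signature, verbatim). -/
theorem stub_partialsDivisible : Sig.stub_partialsDivisible := by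
  intro p _ n _ κ _ _ i t pd sub Phi piE m l g h b hΦ
  -- the `pd` let IS the tree's partial derivative, definitionally
  have hpd : ∀ l f, pd l f = Literature.RingTheory.MvPowerSeries.pd l f := fun _ _ => rfl
  rw [hpd]
  -- the substitution family of step `k` (the family inlined in `sub (i k) (t k)`)
  exact pdiv_main p i t
    (a := fun k j => @ite (MvPowerSeries (Fin n) κ) (j = i k) (Classical.dec _) (MvPowerSeries.X (i k))
      (MvPowerSeries.X (i k) * (MvPowerSeries.X j + MvPowerSeries.C (t k j))))
    (fun _ => if_pos rfl) (fun _ _ hj => if_neg hj) (Phi := Phi) (piE := piE)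
    (fun _ => rfl) (fun _ _ => rfl) rfl (fun _ => rfl) m l g h b hΦ

end Summit.ResolutionOfSingularities.ResolutionOfSingularities.Theorems.NarrowRunsDie

end
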